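import Summits.Ventures.PercRepro.RankLevelSetExplicitLin2BandBelow
import Summits.Ventures.PercRepro.RankLevelSetExplicitLin2CubeFloor
import Summits.Ventures.PercRepro.RankLevelSetExplicitLin2QuartFloor

/-!
# PercRepro — THE BAND BELOW THE CUBIC AND THE QUARTIC FLOOR TABLES (p9, S4; p4's lever)

`proofs/SUBCLAIM-S4-p9.md` §S4.2⁗‴. The instances of RankLevelSetExplicitLin2BandBelow at the cubic table `PfloorC`
(RankLevelSetExplicitLin2CubeFloor) and the quartic table `PfloorQ` (RankLevelSetExplicitLin2QuartFloor): every core cell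
outside the band below the table is closed, and the crux is its band cells below the table — at level `10` the band is
empty from rank `3 294` (cubic) / `2 126` (quartic) on. Axioms: standard.
-/

open scoped Matroid

namespace PercRepro

namespace ThmN

variable {α : Type}

/-- Every core cell outside the band below the cubic table is closed (`q ≥ 8`). -/
theorem rls_core_of_not_bandBelowC (q : ℕ) (hq : 8 ≤ q) (M : Matroid α) [M.Finite] (p d : ℕ)
    (hR : M.eRank = (p : ℕ∞)) (hn : M.E.ncard = p + d)
    (hfree : ∀ e ∈ M.E, ∃ A ⊆ M.E \ {e}, e ∉ M.closure A ∧ e ∉ M.closure ((M.E \ {e}) \ A))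
    (hb : ¬ BandOpenBelow PfloorC q p d) : RLS M p q :=
  rls_core_of_not_bandBelow PfloorC (fun q hq {_} M _ p hp => c025_floorC q hq M p hp) q hq M p d hR hn hfree hb

/-- **THE CRUX IS ITS BAND CELLS BELOW THE CUBIC TABLE** (both directions). -/
theorem c025_iff_bandBelowC_cells :
    C025 ↔ (∀ q, 4 ≤ q → ∀ {α : Type} (M : Matroid α) [M.Finite] (p : ℕ), q + 2 ≤ p → p ≤ q * 2 ^ (q + 1) →
      M.E.ncard < Nexp p q → (∀ e ∈ M.E, ∀ f ∈ M.E, e ≠ f → M.eRk {e, f} = 2) → M.eRank = (p : ℕ∞) →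
      (∀ e, ¬ M.IsColoop e) →
      (∀ e ∈ M.E, ∃ A ⊆ M.E \ {e}, e ∉ M.closure A ∧ e ∉ M.closure ((M.E \ {e}) \ A)) →
      (8 ≤ q → BandOpenBelow PfloorC q p (M.E.ncard - p)) → RLS M p q) :=
  c025_iff_bandBelow_cells PfloorC (fun q hq {_} M _ p hp => c025_floorC q hq M p hp)

/-- At level `10` the band below the cubic table is empty from rank `3 294` on. -/
theorem not_bandOpenBelowC_ten (p d : ℕ) (hp : 3294 ≤ p) : ¬ BandOpenBelow PfloorC 10 p d :=
  not_bandOpenBelow_of_le PfloorC 10 p d (by unfold PfloorC; norm_num; omega)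

/-- Every core cell outside the band below the quartic table is closed (`q ≥ 8`). -/
theorem rls_core_of_not_bandBelowQ (q : ℕ) (hq : 8 ≤ q) (M : Matroid α) [M.Finite] (p d : ℕ)
    (hR : M.eRank = (p : ℕ∞)) (hn : M.E.ncard = p + d)
    (hfree : ∀ e ∈ M.E, ∃ A ⊆ M.E \ {e}, e ∉ M.closure A ∧ e ∉ M.closure ((M.E \ {e}) \ A))
    (hb : ¬ BandOpenBelow PfloorQ q p d) : RLS M p q :=
  rls_core_of_not_bandBelow PfloorQ (fun q hq {_} M _ p hp => c025_floorQ q hq M p hp) q hq M p d hR hn hfree hb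

/-- **THE CRUX IS ITS BAND CELLS BELOW THE QUARTIC TABLE** (both directions). -/
theorem c025_iff_bandBelowQ_cells :
    C025 ↔ (∀ q, 4 ≤ q → ∀ {α : Type} (M : Matroid α) [M.Finite] (p : ℕ), q + 2 ≤ p → p ≤ q * 2 ^ (q + 1) →
      M.E.ncard < Nexp p q → (∀ e ∈ M.E, ∀ f ∈ M.E, e ≠ f → M.eRk {e, f} = 2) → M.eRank = (p : ℕ∞) →
      (∀ e, ¬ M.IsColoop e) →
      (∀ e ∈ M.E, ∃ A ⊆ M.E \ {e}, e ∉ M.closure A ∧ e ∉ M.closure ((M.E \ {e}) \ A)) →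
      (8 ≤ q → BandOpenBelow PfloorQ q p (M.E.ncard - p)) → RLS M p q) :=
  c025_iff_bandBelow_cells PfloorQ (fun q hq {_} M _ p hp => c025_floorQ q hq M p hp)

/-- At level `10` the band below the quartic table is empty from rank `2 126` on. -/
theorem not_bandOpenBelowQ_ten (p d : ℕ) (hp : 2126 ≤ p) : ¬ BandOpenBelow PfloorQ 10 p d :=
  not_bandOpenBelow_of_le PfloorQ 10 p d (by unfold PfloorQ; norm_num; omega)

end ThmN

end PercRepro
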